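import Literature.Analysis.FunctionSpaces.TorusLineIntegrals
import Literature.Analysis.FunctionSpaces.TorusSobolevNormProofs
import HarnessLib

/-!
# Absolutely continuous representatives on coordinate lines for the spectral `H¹` of the torus

Analysis/FunctionSpaces support file (everything proved; no definitions, no named facts; global
`volume` convention of `FlatTorus`, statements through `UnitAddTorus.mFourierCoeff`).

The classical **ACL property** of Sobolev functions (Beppo Levi 1906, Nikodym 1933; Evans–Gariepy,
*Measure Theory and Fine Properties of Functions*, §4.9.2, Thm. 2; Ziemer, *Weakly Differentiable
Functions*, Thm. 2.1.4; Maz'ya, *Sobolev Spaces*, §1.1.3) says that `u ∈ W^{1,1}` has a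
representative that is absolutely continuous on almost every line parallel to a coordinate axis,
its classical partial derivative along those lines being the weak one. On the flat torus
`T^d = (ℝ/ℤ)^d` and for ONE coordinate `p`, with the weak derivative given on the Fourier side,
this reads: if `g, h ∈ L¹(T^d; F)` (complex Banach space `F`) satisfy
`ĥ(n) = 2πi nₚ ĝ(n)` for all `n ∈ ℤ^d` (so `h` is the weak `p`-th derivative of `g`,
`Torus.hasWeakPartialDeriv_of_forall_mFourierCoeff_eq`), then the **explicit representative**

  `g̃(x) = ∫₀¹ g(x + τ𝐞ₚ) dτ + ∫₀¹ τ · h(x + τ𝐞ₚ) dτ`     (`𝐞ₚ τ = Pi.single p (τ : ℝ/ℤ)`)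

agrees with `g` almost everywhere (`Torus.lineRep_ae_eq`) and, for almost every `x ∈ T^d`, the line
function `t ↦ g̃(x + t𝐞ₚ)` is the primitive of the locally integrable `t ↦ h(x + t𝐞ₚ)`:

  `g̃(x + t𝐞ₚ) = g̃(x) + ∫₀ᵗ h(x + τ𝐞ₚ) dτ`  for all `t ∈ ℝ`     (`Torus.lineRep_add_single`),

hence absolutely continuous on every period (`Torus.exists_lineAC_representative` packages both).
Consequences: the mean-value form of the fundamental theorem of calculus
`g(x + σ𝐞ₚ) - g(x) = ∫₀^σ h(x + τ𝐞ₚ) dτ` for a.e. `x`, every `σ`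
(`Torus.ae_translate_sub_eq_intervalIntegral`), and the `L²` version for the Fourier-side space
`{g ∈ L² : ∑ₙ nₚ² ‖ĝ(n)‖² < ∞}` of `TorusLipschitzFourierH1`, where `h` is produced by Riesz–Fischer
with `‖h‖₂² = 4π² ∑ₙ nₚ² ‖ĝ(n)‖²` (`Torus.exists_lineDeriv_of_tsum_ne_top`,
`Torus.exists_lineAC_representative_of_tsum_ne_top`).

## Proof

No maximal functions and no approximation (`TorusLineIntegrals` supplies the tools): the Fourier
coefficients of the weighted line averages are `𝓕g̃(n) = 𝟙[nₚ=0] ĝ(n) + (∫₀¹ τe^{2πi nₚτ}dτ) ĥ(n) = ĝ(n)`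
and `𝓕(∫₀¹ h(· + τ𝐞ₚ)dτ)(n) = 𝟙[nₚ=0] ĥ(n) = 0`, so `g̃ = g` a.e. and the loop integrals
`∫₀¹ h(x + τ𝐞ₚ) dτ` vanish a.e. (uniqueness of Fourier coefficients in `L¹`, Grafakos 2014,
Prop. 3.2.4, `Torus.ae_eq_of_forall_mFourierCoeff_eq`); along every line on which `h` is locally
integrable with vanishing loop integral, the averaged primitive satisfies
`g̃(x + t𝐞ₚ) = g̃(x) + ∫₀ᵗ h(x + τ𝐞ₚ)dτ` exactly (`intervalIntegral_avgPrimitive_eq`), and a.e. line is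
such (`Torus.ae_intervalIntegrable_comp_add_single`).

## Mathlib / tree search

Mathlib: no Sobolev space on the torus, no ACL theorem (searched `AbsolutelyContinuous.*Sobolev`,
`ACL`, `absolutely continuous on lines`: none). Tree: `Torus.ae_eq_of_forall_mFourierCoeff_eq`,
`Torus.exists_memLp_two_forall_mFourierCoeff_eq_of_summable`, `Torus.tsum_enorm_sq_mFourierCoeff_eq_eLpNorm_sq`
(`TorusSobolevNormProofs`), `Torus.hasWeakPartialDeriv_of_forall_mFourierCoeff_eq` (same coefficient
convention, `TorusSobolevNormWeakDerivProofs`), `TorusLineIntegrals` (shear, line averages).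

## References

* L. C. Evans, R. F. Gariepy, *Measure Theory and Fine Properties of Functions*, CRC (1992),
  §4.9.2, Thm. 2 (ACL characterisation of `W^{1,p}`). [EvansGariepy1992]
* W. P. Ziemer, *Weakly Differentiable Functions*, GTM 120, Springer (1989), Thm. 2.1.4.
* L. Grafakos, *Classical Fourier Analysis*, 3rd ed. (2014), Prop. 3.2.4, Prop. 3.2.7. [Grafakos2014]
-/

noncomputable section

open MeasureTheory Set Filter Function intervalIntegral UnitAddTorus Complex
open scoped ENNReal NNReal Topology

namespace Literature.Analysis.FunctionSpaces

namespace Torus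

variable {d : Type*} [Fintype d] [DecidableEq d]

/-! ## The absolutely continuous representative -/

section Representative

variable {F : Type*} [NormedAddCommGroup F] [NormedSpace ℂ F] [CompleteSpace F]

/-- **Loop integrals of a weak line derivative vanish a.e.**: if `g, h ∈ L¹(T^d)` with
`ĥ(n) = 2πi nₚ ĝ(n)`, then `∫₀¹ h(x + τ𝐞ₚ) dτ = 0` for a.e. `x` (its Fourier coefficients are
`𝟙[nₚ = 0] ĥ(n) = 0`). [folklore] -/
theorem ae_intervalIntegral_lineDeriv_eq_zero (p : d) {g h : UnitAddTorus d → F}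
    (hh : Integrable h volume)
    (hcoeff : ∀ n : d → ℤ, mFourierCoeff h n = (2 * Real.pi * I * (n p)) • mFourierCoeff g n) :
    ∀ᵐ x ∂(volume : Measure (UnitAddTorus d)),
      ∫ τ in (0 : ℝ)..1, h (x + Pi.single p ((τ : ℝ) : UnitAddCircle)) = 0 := by
  have hint := integrable_lineAvg hh p (w := fun _ => (1 : ℂ)) continuous_const
  have hF := mFourierCoeff_lineAvg hh p (w := fun _ => (1 : ℂ)) continuous_const
  simp only [one_smul, one_mul] at hint hF
  have hzero : ∀ n, mFourierCoeff
      (fun x : UnitAddTorus d => ∫ τ in (0 : ℝ)..1, h (x + Pi.single p ((τ : ℝ) : UnitAddCircle))) n = 0 := by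
    intro n
    rw [hF n, intervalIntegral_fourier_coe, hcoeff n]
    by_cases hn : n p = 0
    · simp [hn]
    · simp [hn]
  exact ae_eq_zero_of_forall_mFourierCoeff_eq_zero hint hzero

/-- **The explicit representative has the Fourier coefficients of `g`**: with
`g̃(x) = ∫₀¹ g(x + τ𝐞ₚ) dτ + ∫₀¹ τ • h(x + τ𝐞ₚ) dτ` and `ĥ(n) = 2πi nₚ ĝ(n)`,
`𝓕g̃(n) = 𝟙[nₚ=0] ĝ(n) + (∫₀¹ τe^{2πi nₚ τ}dτ) 2πi nₚ ĝ(n) = ĝ(n)`. [folklore] -/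
theorem mFourierCoeff_lineRep (p : d) {g h : UnitAddTorus d → F} (hg : Integrable g volume)
    (hh : Integrable h volume)
    (hcoeff : ∀ n : d → ℤ, mFourierCoeff h n = (2 * Real.pi * I * (n p)) • mFourierCoeff g n)
    (n : d → ℤ) :
    mFourierCoeff (fun x : UnitAddTorus d => (∫ τ in (0 : ℝ)..1, g (x + Pi.single p ((τ : ℝ) : UnitAddCircle))) +
        ∫ τ in (0 : ℝ)..1, ((τ : ℝ) : ℂ) • h (x + Pi.single p ((τ : ℝ) : UnitAddCircle))) n =
      mFourierCoeff g n := by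
  have hint1 := integrable_lineAvg hg p (w := fun _ => (1 : ℂ)) continuous_const
  have hF1 := mFourierCoeff_lineAvg hg p (w := fun _ => (1 : ℂ)) continuous_const n
  simp only [one_smul, one_mul] at hint1 hF1
  have hint2 := integrable_lineAvg hh p (w := fun τ : ℝ => ((τ : ℝ) : ℂ)) continuous_ofReal
  have hF2 := mFourierCoeff_lineAvg hh p (w := fun τ : ℝ => ((τ : ℝ) : ℂ)) continuous_ofReal n
  have hadd := mFourierCoeff_add hint1 hint2 n
  rw [show (fun x : UnitAddTorus d => (∫ τ in (0 : ℝ)..1, g (x + Pi.single p ((τ : ℝ) : UnitAddCircle))) +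
        ∫ τ in (0 : ℝ)..1, ((τ : ℝ) : ℂ) • h (x + Pi.single p ((τ : ℝ) : UnitAddCircle))) =
      (fun x : UnitAddTorus d => ∫ τ in (0 : ℝ)..1, g (x + Pi.single p ((τ : ℝ) : UnitAddCircle))) +
        fun x : UnitAddTorus d => ∫ τ in (0 : ℝ)..1, ((τ : ℝ) : ℂ) • h (x + Pi.single p ((τ : ℝ) : UnitAddCircle))
      from rfl, hadd, hF1, hF2, hcoeff n, intervalIntegral_fourier_coe]
  by_cases hn : n p = 0
  · simp [hn]
  · rw [intervalIntegral_coe_mul_fourier_coe hn, if_neg hn, zero_smul, zero_add, smul_smul]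
    have hc0 : (2 * Real.pi * I * (n p : ℂ)) ≠ 0 :=
      mul_ne_zero (mul_ne_zero (mul_ne_zero two_ne_zero (ofReal_ne_zero.2 Real.pi_pos.ne'))
        I_ne_zero) (Int.cast_ne_zero.2 hn)
    rw [one_div, inv_mul_cancel₀ hc0, one_smul]

/-- **The explicit representative agrees with `g` a.e.** (uniqueness of Fourier coefficients in
`L¹(T^d)`, Grafakos 2014, Prop. 3.2.4). [cite: Grafakos2014, Prop. 3.2.4] -/
theorem lineRep_ae_eq (p : d) {g h : UnitAddTorus d → F} (hg : Integrable g volume)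
    (hh : Integrable h volume)
    (hcoeff : ∀ n : d → ℤ, mFourierCoeff h n = (2 * Real.pi * I * (n p)) • mFourierCoeff g n) :
    (fun x : UnitAddTorus d => (∫ τ in (0 : ℝ)..1, g (x + Pi.single p ((τ : ℝ) : UnitAddCircle))) +
        ∫ τ in (0 : ℝ)..1, ((τ : ℝ) : ℂ) • h (x + Pi.single p ((τ : ℝ) : UnitAddCircle))) =ᵐ[volume] g := by
  have hint1 := integrable_lineAvg hg p (w := fun _ => (1 : ℂ)) continuous_const
  simp only [one_smul] at hint1
  have hint2 := integrable_lineAvg hh p (w := fun τ : ℝ => ((τ : ℝ) : ℂ)) continuous_ofReal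
  exact ae_eq_of_forall_mFourierCoeff_eq (hint1.add hint2) hg (mFourierCoeff_lineRep p hg hh hcoeff)

omit [Fintype d] [CompleteSpace F] in
/-- **The explicit representative is a primitive along every good line**: if the line function
`τ ↦ h(x + τ𝐞ₚ)` is integrable on bounded intervals and the loop integral `∫₀¹ h(x + τ𝐞ₚ) dτ`
vanishes, then `g̃(x + t𝐞ₚ) = g̃(x) + ∫₀ᵗ h(x + τ𝐞ₚ) dτ` for every real `t`. [folklore] -/
theorem lineRep_add_single (p : d) (g : UnitAddTorus d → F) {h : UnitAddTorus d → F} {x : UnitAddTorus d}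
    (hhx : ∀ a b : ℝ, IntervalIntegrable (fun τ : ℝ => h (x + Pi.single p ((τ : ℝ) : UnitAddCircle))) volume a b)
    (hΛ : ∫ τ in (0 : ℝ)..1, h (x + Pi.single p ((τ : ℝ) : UnitAddCircle)) = 0) (t : ℝ) :
    (∫ τ in (0 : ℝ)..1, g (x + Pi.single p ((t : ℝ) : UnitAddCircle) + Pi.single p ((τ : ℝ) : UnitAddCircle))) +
        ∫ τ in (0 : ℝ)..1, ((τ : ℝ) : ℂ) •
          h (x + Pi.single p ((t : ℝ) : UnitAddCircle) + Pi.single p ((τ : ℝ) : UnitAddCircle)) =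
      ((∫ τ in (0 : ℝ)..1, g (x + Pi.single p ((τ : ℝ) : UnitAddCircle))) +
          ∫ τ in (0 : ℝ)..1, ((τ : ℝ) : ℂ) • h (x + Pi.single p ((τ : ℝ) : UnitAddCircle))) +
        ∫ τ in (0 : ℝ)..t, h (x + Pi.single p ((τ : ℝ) : UnitAddCircle)) := by
  simp only [add_single_add_single]
  exact intervalIntegral_avgPrimitive_eq (periodic_comp_add_single g p x)
    (periodic_comp_add_single h p x) hhx hΛ t

/-- **Absolutely continuous representatives on lines (ACL), one coordinate, Fourier form.**
Let `g, h ∈ L¹(T^d; F)` (`F` a complex Banach space) with `ĥ(n) = 2πi nₚ ĝ(n)` for all `n ∈ ℤ^d`.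
Then there is `g̃ = g` a.e., integrable, such that for a.e. `x ∈ T^d` the line function
`τ ↦ h(x + τ𝐞ₚ)` is integrable on every bounded interval and
`g̃(x + t𝐞ₚ) = g̃(x) + ∫₀ᵗ h(x + τ𝐞ₚ) dτ` for **every** `t ∈ ℝ` (so `t ↦ g̃(x + t𝐞ₚ)` is absolutely
continuous with a.e. derivative `h(x + t𝐞ₚ)`). Evans–Gariepy §4.9.2 Thm. 2 / Ziemer Thm. 2.1.4, torus
version with the explicit representative `g̃ = ∫₀¹ g(· + τ𝐞ₚ)dτ + ∫₀¹ τ h(· + τ𝐞ₚ)dτ`.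
[cite: EvansGariepy1992, §4.9.2 Thm. 2] -/
theorem exists_lineAC_representative (p : d) {g h : UnitAddTorus d → F} (hg : Integrable g volume)
    (hh : Integrable h volume)
    (hcoeff : ∀ n : d → ℤ, mFourierCoeff h n = (2 * Real.pi * I * (n p)) • mFourierCoeff g n) :
    ∃ g' : UnitAddTorus d → F, g' =ᵐ[volume] g ∧ Integrable g' volume ∧
      ∀ᵐ x ∂(volume : Measure (UnitAddTorus d)),
        (∀ a b : ℝ, IntervalIntegrable
          (fun τ : ℝ => h (x + Pi.single p ((τ : ℝ) : UnitAddCircle))) volume a b) ∧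
        ∀ t : ℝ, g' (x + Pi.single p ((t : ℝ) : UnitAddCircle)) =
          g' x + ∫ τ in (0 : ℝ)..t, h (x + Pi.single p ((τ : ℝ) : UnitAddCircle)) := by
  have hint1 := integrable_lineAvg hg p (w := fun _ => (1 : ℂ)) continuous_const
  simp only [one_smul] at hint1
  have hint2 := integrable_lineAvg hh p (w := fun τ : ℝ => ((τ : ℝ) : ℂ)) continuous_ofReal
  refine ⟨_, lineRep_ae_eq p hg hh hcoeff, hint1.add hint2, ?_⟩
  filter_upwards [ae_intervalIntegrable_comp_add_single hh p,
    ae_intervalIntegral_lineDeriv_eq_zero p hh hcoeff] with x hhx hΛ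
  exact ⟨hhx, fun t => lineRep_add_single p g hhx hΛ t⟩

/-- **Fundamental theorem of calculus in the mean**: under the same hypotheses, for every `σ ∈ ℝ`
and a.e. `x ∈ T^d`, `g(x + σ𝐞ₚ) - g(x) = ∫₀^σ h(x + τ𝐞ₚ) dτ` (the representative may be
replaced by `g` at the two points `x`, `x + σ𝐞ₚ` for a.e. `x`, the axis translation being measure
preserving). [folklore] -/
theorem ae_translate_sub_eq_intervalIntegral (p : d) {g h : UnitAddTorus d → F}
    (hg : Integrable g volume) (hh : Integrable h volume)
    (hcoeff : ∀ n : d → ℤ, mFourierCoeff h n = (2 * Real.pi * I * (n p)) • mFourierCoeff g n)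
    (σ : ℝ) :
    ∀ᵐ x ∂(volume : Measure (UnitAddTorus d)),
      g (x + Pi.single p ((σ : ℝ) : UnitAddCircle)) - g x =
        ∫ τ in (0 : ℝ)..σ, h (x + Pi.single p ((τ : ℝ) : UnitAddCircle)) := by
  obtain ⟨g', hg'g, -, hline⟩ := exists_lineAC_representative p hg hh hcoeff
  have hσ : ∀ᵐ x ∂(volume : Measure (UnitAddTorus d)),
      g' (x + Pi.single p ((σ : ℝ) : UnitAddCircle)) = g (x + Pi.single p ((σ : ℝ) : UnitAddCircle)) :=
    (measurePreserving_add_single p ((σ : ℝ) : UnitAddCircle)).quasiMeasurePreserving.ae_eq hg'g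
  filter_upwards [hg'g, hσ, hline] with x hx hxσ hx'
  rw [← hx, ← hxσ, (hx'.2 σ)]
  abel

end Representative

/-! ## The `L²` spectral Sobolev space: existence of the line derivative -/

section Hilbert

variable {F : Type*} [NormedAddCommGroup F] [InnerProductSpace ℂ F] [CompleteSpace F]

omit [DecidableEq d] in
/-- **Riesz–Fischer for the line derivative.** If `g : T^d → F` (`F` a Hilbert space) has
`∑ₙ nₚ² ‖ĝ(n)‖² < ∞`, there is `h ∈ L²(T^d; F)` with `ĥ(n) = 2πi nₚ ĝ(n)` for all `n`, and
`‖h‖₂² = 4π² ∑ₙ nₚ² ‖ĝ(n)‖²` (Parseval). Only the coefficients of `g` enter, so no hypothesis on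
`g` itself is needed. [cite: Grafakos2014, Prop. 3.2.7 (4)] -/
theorem exists_lineDeriv_of_tsum_ne_top (p : d) {g : UnitAddTorus d → F}
    (hH : ∑' n : d → ℤ, ENNReal.ofReal ((n p : ℝ) ^ 2) * ‖mFourierCoeff g n‖ₑ ^ 2 ≠ ⊤) :
    ∃ h : UnitAddTorus d → F, MemLp h 2 volume ∧
      (∀ n : d → ℤ, mFourierCoeff h n = (2 * Real.pi * I * (n p)) • mFourierCoeff g n) ∧
      eLpNorm h 2 volume ^ 2 =
        ENNReal.ofReal ((2 * Real.pi) ^ 2) *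
          ∑' n : d → ℤ, ENNReal.ofReal ((n p : ℝ) ^ 2) * ‖mFourierCoeff g n‖ₑ ^ 2 := by
  set a : (d → ℤ) → F := fun n => (2 * Real.pi * I * (n p)) • mFourierCoeff g n with ha
  -- `‖a n‖ₑ² = (2π)² nₚ² ‖ĝ n‖ₑ²`
  have hnorm : ∀ n, ‖a n‖ₑ ^ 2 =
      ENNReal.ofReal ((2 * Real.pi) ^ 2) * (ENNReal.ofReal ((n p : ℝ) ^ 2) * ‖mFourierCoeff g n‖ₑ ^ 2) := by
    intro n
    have hc : ‖(2 * Real.pi * I * (n p) : ℂ)‖ = 2 * Real.pi * |(n p : ℝ)| := by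
      simp only [norm_mul, Complex.norm_ofNat, norm_real, Real.norm_eq_abs, norm_I, mul_one,
        norm_intCast, abs_of_pos Real.pi_pos]
    have hsq : (2 * Real.pi * |(n p : ℝ)|) ^ 2 = (2 * Real.pi) ^ 2 * (n p : ℝ) ^ 2 := by
      rw [mul_pow, sq_abs]
    rw [ha]
    simp only
    rw [enorm_smul, mul_pow, ← ofReal_norm, hc, ← ENNReal.ofReal_pow (by positivity), hsq,
      ENNReal.ofReal_mul (sq_nonneg _), mul_assoc]
  have hsum_enorm : ∑' n, ‖a n‖ₑ ^ 2 =
      ENNReal.ofReal ((2 * Real.pi) ^ 2) *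
        ∑' n : d → ℤ, ENNReal.ofReal ((n p : ℝ) ^ 2) * ‖mFourierCoeff g n‖ₑ ^ 2 := by
    simp_rw [hnorm]
    exact ENNReal.tsum_mul_left
  have hlt : ∑' n, ‖a n‖ₑ ^ 2 < ⊤ := by
    rw [hsum_enorm]
    exact ENNReal.mul_lt_top ENNReal.ofReal_lt_top hH.lt_top
  -- real summability of `‖a n‖²`
  have hsumm : Summable fun n => ‖a n‖ ^ 2 := by
    have h2 : ∑' n, ((‖a n‖₊ ^ 2 : ℝ≥0) : ℝ≥0∞) ≠ ⊤ := by
      simp_rw [ENNReal.coe_pow, ← enorm_eq_nnnorm]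
      exact hlt.ne
    have h3 := ENNReal.tsum_coe_ne_top_iff_summable.1 h2
    have h4 : Summable fun n => ((‖a n‖₊ ^ 2 : ℝ≥0) : ℝ) := NNReal.summable_coe.2 h3
    simpa using h4
  obtain ⟨h, hh2, hhc⟩ := exists_memLp_two_forall_mFourierCoeff_eq_of_summable hsumm
  refine ⟨h, hh2, hhc, ?_⟩
  rw [← tsum_enorm_sq_mFourierCoeff_eq_eLpNorm_sq hh2]
  simp_rw [hhc]
  exact hsum_enorm

/-- **ACL for the spectral `H¹` along one coordinate, `L²` form.** For `g ∈ L²(T^d; F)` with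
`∑ₙ nₚ² ‖ĝ(n)‖² < ∞` there are `h ∈ L²` (the weak derivative `∂ₚ g`: `ĥ(n) = 2πi nₚ ĝ(n)`,
`‖h‖₂² = 4π² ∑ₙ nₚ² ‖ĝ(n)‖²`) and a representative `g̃ = g` a.e. such that for a.e. `x` the line
function `τ ↦ h(x + τ𝐞ₚ)` is locally integrable and `g̃(x + t𝐞ₚ) = g̃(x) + ∫₀ᵗ h(x + τ𝐞ₚ) dτ`
for all real `t`. Evans–Gariepy §4.9.2 Thm. 2, Fourier/torus dress. [cite: EvansGariepy1992, §4.9.2 Thm. 2] -/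
theorem exists_lineAC_representative_of_tsum_ne_top (p : d) {g : UnitAddTorus d → F}
    (hg : MemLp g 2 volume)
    (hH : ∑' n : d → ℤ, ENNReal.ofReal ((n p : ℝ) ^ 2) * ‖mFourierCoeff g n‖ₑ ^ 2 ≠ ⊤) :
    ∃ h : UnitAddTorus d → F, MemLp h 2 volume ∧
      (∀ n : d → ℤ, mFourierCoeff h n = (2 * Real.pi * I * (n p)) • mFourierCoeff g n) ∧
      eLpNorm h 2 volume ^ 2 =
        ENNReal.ofReal ((2 * Real.pi) ^ 2) *
          ∑' n : d → ℤ, ENNReal.ofReal ((n p : ℝ) ^ 2) * ‖mFourierCoeff g n‖ₑ ^ 2 ∧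
      ∃ g' : UnitAddTorus d → F, g' =ᵐ[volume] g ∧ Integrable g' volume ∧
        ∀ᵐ x ∂(volume : Measure (UnitAddTorus d)),
          (∀ a b : ℝ, IntervalIntegrable
            (fun τ : ℝ => h (x + Pi.single p ((τ : ℝ) : UnitAddCircle))) volume a b) ∧
          ∀ t : ℝ, g' (x + Pi.single p ((t : ℝ) : UnitAddCircle)) =
            g' x + ∫ τ in (0 : ℝ)..t, h (x + Pi.single p ((τ : ℝ) : UnitAddCircle)) := by
  haveI : IsFiniteMeasure (volume : Measure (UnitAddTorus d)) := inferInstance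
  obtain ⟨h, hh2, hhc, hnorm⟩ := exists_lineDeriv_of_tsum_ne_top p hH
  exact ⟨h, hh2, hhc, hnorm, exists_lineAC_representative p (hg.integrable one_le_two)
    (hh2.integrable one_le_two) hhc⟩

end Hilbert

end Torus

end Literature.Analysis.FunctionSpaces

end
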